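import Literature.AlgebraicGeometry.RealAlgebraic.ProductCoordinates
import Literature.AlgebraicGeometry.RealAlgebraic.RealAlgebraicMorphisms
import Literature.AlgebraicGeometry.RealAlgebraic.RealAlgebraicSubmanifold
import Literature.AlgebraicGeometry.RealAlgebraic.EmbeddedGroupCoframe
import Literature.AlgebraicGeometry.RealAlgebraic.SemialgebraicOverRealAlgebraicField
import Literature.AlgebraicGeometry.RealAlgebraic.RealAbelJacobi
import Literature.AlgebraicGeometry.Motives.AbelianVarietyProjectiveChart
import Literature.AlgebraicGeometry.Motives.VarietiesProperProofs
import Literature.AlgebraicGeometry.Motives.SegreEmbedding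
import HarnessLib

/-!
# Real points of a curve and of its Jacobian: existence of a realization

This file discharges the named fact
`Literature.AlgebraicGeometry.RealAlgebraic.RealAbelJacobi.exists_realization`
(file `RealAlgebraic/RealAbelJacobi`): for a real-algebraic field `k ⊆ ℝ`, a smooth projective
geometrically irreducible curve `C/k` with a rational point `P₀` and a Jacobian `𝒥` of `C`, the
real points `C(ℝ)`, `J(ℝ)` with the group law and the Abel–Jacobi map `f^{P₀}` form a real
Abel–Jacobi package `RealAbelJacobi M N g` realised by `(C, P₀, 𝒥)`.

The construction (Gross–Harris §1–2 take all of it for granted; we assemble it from the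
preceding files of this directory):

* **coordinates** (`realCoordSystem`): a smooth projective `X ⊆ ℙⁿ_k` carries the algebraic
  coordinate system `x_a x_b / Σ x_c²` on the Zariski open `Σ x_c² ≠ 0` containing all real points
  (`RealAlgebraic/VeroneseCoordinates`, Akbulut–King II Prop. 2.4.1; Bochnak–Coste–Roy
  Thm. 3.4.4), whence a closed topological embedding `X(ℝ) ↪ ℝ^M` with compact,
  `k`-semialgebraic image which is a `C^∞` submanifold of dimension `dim X`
  (`RealAlgebraic/RealAlgebraicCoordinates`, `RealAlgebraic/RealAlgebraicSubmanifold`;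
  BCR Prop. 3.3.11); `k`-semialgebraic sets are `ℚ`-semialgebraic since `k/ℚ` is algebraic
  (`RealAlgebraic/SemialgebraicOverRealAlgebraicField`);
* **morphisms** (`RealAlgebraic/RealAlgebraicMorphisms`): the group law `J × J → J` (in the
  product coordinates of `RealAlgebraic/ProductCoordinates`), the inversion and `f^{P₀} : C → J`
  are restrictions of `C^∞` maps of the ambient spaces, semialgebraic on the real points;
* **the invariant coframe** of the embedded compact abelian Nash group `J(ℝ)`
  (`RealAlgebraic/EmbeddedGroupCoframe`, Serre GACC III no. 11), and the pulled-back forms on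
  `C(ℝ)` through the tangent projections of `RealAlgebraic/SubmanifoldTangent`,
  `RealAlgebraic/SemialgebraicTangent`.

## References

* B. H. Gross, J. Harris, *Real algebraic curves*, Ann. Sci. ÉNS (4) 14 (1981), 157–182, §§1–2.
  [GrossHarris1981]
* J. Bochnak, M. Coste, M.-F. Roy, *Real Algebraic Geometry* (1998), Thm. 3.4.4, Prop. 3.3.11,
  Prop. 2.2.7. [BochnakCosteRoy1998]
* S. Akbulut, H. King, *Topology of Real Algebraic Sets* (1992), Ch. II §4, Prop. 2.4.1.
  [AkbulutKing1992]
* J.-P. Serre, *Algebraic Groups and Class Fields*, GTM 117 (1988), Ch. III no. 11. [Serre1988]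
* J. S. Milne, *Jacobian varieties* (1986), §2. [Milne1986JacobianVarieties]
-/

noncomputable section

open CategoryTheory CategoryTheory.Limits MonoidalCategory CartesianMonoidalCategory
  AlgebraicGeometry Set Filter Function
open _root_.Topology
open scoped ContDiff

universe u

namespace Literature.AlgebraicGeometry.RealAlgebraic

open Literature.AlgebraicGeometry.Motives Literature.NumberTheory.Transcendental
  Literature.ModelTheory.ExponentialFields

/-! ### Generalities -/

section General

variable {m n : ℕ}

/-- A finite sum of `k`-semialgebraic functions is semialgebraic. [cite: BochnakCosteRoy1998, Prop. 2.2.6] -/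
theorem isSemialgebraicFunOn_finset_sum {k : Type*} [Field k] [Algebra k ℝ] {s : Set (Fin m → ℝ)}
    (hs : IsSemialgebraic k s) {ι : Type*} (T : Finset ι) (F : ι → (Fin m → ℝ) → ℝ)
    (hF : ∀ i ∈ T, IsSemialgebraicFunOn k s (F i)) :
    IsSemialgebraicFunOn k s fun x => ∑ i ∈ T, F i x := by
  classical
  induction T using Finset.induction_on with
  | empty =>
    simp only [Finset.sum_empty]
    convert isSemialgebraicFunOn_aeval hs (0 : MvPolynomial (Fin m) k) using 2 with x
    simp
  | insert a T ha ih =>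
    have h := IsSemialgebraicFunOn.add_holds (hF a (Finset.mem_insert_self a T))
      (ih fun i hi => hF i (Finset.mem_insert_of_mem hi))
    convert h using 2 with x
    rw [Finset.sum_insert ha]
    rfl

/-- Appending two vectors is a `C^∞` map `ℝᵐ × ℝⁿ → ℝ^{m+n}`. [folklore] -/
theorem contDiff_append :
    ContDiff ℝ ∞ fun p : (Fin m → ℝ) × (Fin n → ℝ) => (Fin.append p.1 p.2 : Fin (m + n) → ℝ) := by
  refine contDiff_pi.mpr fun idx => ?_
  refine Fin.addCases (motive := fun idx => ContDiff ℝ ∞ fun p : (Fin m → ℝ) × (Fin n → ℝ) =>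
    (Fin.append p.1 p.2 : Fin (m + n) → ℝ) idx) (fun i => ?_) (fun j => ?_) idx
  · simp only [Fin.append_left]
    exact (contDiff_apply ℝ ℝ i).comp contDiff_fst
  · simp only [Fin.append_right]
    exact (contDiff_apply ℝ ℝ j).comp contDiff_snd

end General

/-! ### Real points of a smooth projective variety in Veronese coordinates -/

section SmoothProjective

variable {k : Type} [Field k] {X : SchemeOver k} {d : ℕ}

/-- A smooth projective variety is proper over `k`. [folklore] -/
theorem isProper_of_isSmoothProjective (hX : IsSmoothProjective d X) : IsProper X.hom :=
  IsSmoothProjective.isProper_holds hX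

/-- The underlying space of a smooth projective variety is Noetherian (finite type and
quasi-compact over a field). [folklore] -/
theorem noetherianSpace_of_isSmoothProjective (hX : IsSmoothProjective d X) :
    TopologicalSpace.NoetherianSpace X.left := by
  haveI := hX.smoothOfRelativeDimension
  haveI : Smooth X.hom := SmoothOfRelativeDimension.smooth d _
  haveI : IsProper X.hom := isProper_of_isSmoothProjective hX
  haveI : IsLocallyNoetherian X.left := LocallyOfFiniteType.isLocallyNoetherian X.hom
  haveI : CompactSpace X.left := QuasiCompact.compactSpace_of_compactSpace X.hom
  haveI : IsNoetherian X.left := {}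
  infer_instance

variable [Algebra k ℝ]

/-- A chosen projective embedding of a smooth projective variety. [folklore] -/
def realEmb (hX : IsSmoothProjective d X) : ProjectiveEmbedding X :=
  hX.isProjectiveOver.projectiveEmbedding

/-- The number `(n+1)²` of Veronese coordinates of the chosen embedding `X ⊆ ℙⁿ`. [folklore] -/
def realDim (hX : IsSmoothProjective d X) : ℕ := ((realEmb hX).n + 1) * ((realEmb hX).n + 1)

/-- The Zariski open `Σ x_c² ≠ 0` of the chosen embedding (contains all real points).
[cite: AkbulutKing1992, Ch. II §4, Prop. 2.4.1] -/
def realOpen (hX : IsSmoothProjective d X) : X.left.Opens := veroneseOpen (realEmb hX).ι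

/-- The Veronese coordinates `x_a x_b / Σ x_c²` of the chosen embedding.
[cite: AkbulutKing1992, Ch. II §4, Prop. 2.4.1] -/
def realCoords (hX : IsSmoothProjective d X) : Fin (realDim hX) → Γ(X.left, realOpen hX) :=
  veroneseCoords (realEmb hX).ι

/-- The Veronese coordinates form an algebraic coordinate system on the real points.
[cite: AkbulutKing1992, Ch. II §4, Prop. 2.4.1] [cite: BochnakCosteRoy1998, Thm. 3.4.4] -/
theorem realCoordSystem (hX : IsSmoothProjective d X) :
    IsAlgCoordSystem ℝ (realOpen hX) (realCoords hX) :=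
  isAlgCoordSystem_veronese (realEmb hX).ι

/-- The coordinate embedding `X(ℝ) → ℝ^M`. [folklore] -/
def realPt (hX : IsSmoothProjective d X) : AlgPoints X ℝ → (Fin (realDim hX) → ℝ) :=
  coordMap ℝ (realOpen hX) (realCoords hX)

/-- `realPt` is a closed topological embedding. [cite: AkbulutKing1992, Ch. II §4, Cor. 2.4.2] -/
theorem isClosedEmbedding_realPt (hX : IsSmoothProjective d X) : IsClosedEmbedding (realPt hX) := by
  haveI := isProper_of_isSmoothProjective hX
  exact (realCoordSystem hX).isClosedEmbedding

/-- The image `realPt (X(ℝ))` is compact. [folklore] -/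
theorem isCompact_range_realPt (hX : IsSmoothProjective d X) : IsCompact (range (realPt hX)) := by
  haveI := isProper_of_isSmoothProjective hX
  exact (realCoordSystem hX).isCompact_range

/-- The image `realPt (X(ℝ))` is `k`-semialgebraic. [cite: BochnakCosteRoy1998, Prop. 2.2.7] -/
theorem isSemialgebraic_range_realPt (hX : IsSmoothProjective d X) :
    IsSemialgebraic k (range (realPt hX)) := by
  haveI := noetherianSpace_of_isSmoothProjective hX
  exact (realCoordSystem hX).isSemialgebraic_range

/-- The image `realPt (X(ℝ))` is a `C^∞` submanifold of dimension `dim X`.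
[cite: BochnakCosteRoy1998, Prop. 3.3.11] -/
theorem isSubmanifoldOfDim_range_realPt (hX : IsSmoothProjective d X) :
    IsSubmanifoldOfDim d (range (realPt hX)) := by
  haveI := isProper_of_isSmoothProjective hX
  haveI := hX.smoothOfRelativeDimension
  exact (realCoordSystem hX).isSubmanifoldOfDim_range d

/-- Regular functions are `k`-semialgebraic functions of the coordinates.
[cite: BochnakCosteRoy1998, Prop. 2.2.7] -/
theorem exists_isSemialgebraicFunOn_eval_realPt (hX : IsSmoothProjective d X) {U : X.left.Opens}
    (s : Γ(X.left, U)) :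
    ∃ F : (Fin (realDim hX) → ℝ) → ℝ, IsSemialgebraicFunOn k (realPt hX '' {Q | Q.pt ∈ U}) F ∧
      ∀ (Q : AlgPoints X ℝ) (hQ : Q.pt ∈ U), F (realPt hX Q) = Q.eval U hQ s := by
  haveI := noetherianSpace_of_isSmoothProjective hX
  exact (realCoordSystem hX).exists_isSemialgebraicFunOn_eval s

/-- **Morphisms in coordinates** (from `X` smooth projective): a `C^∞` ambient map, semialgebraic
on the real points. [cite: BochnakCosteRoy1998, Def. 2.2.5 and Prop. 2.2.7] -/
theorem exists_contDiff_realPt_map (hX : IsSmoothProjective d X) {Y : SchemeOver k} {N' : ℕ}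
    {V' : Y.left.Opens} {f' : Fin N' → Γ(Y.left, V')} (hcY : IsAlgCoordSystem ℝ V' f')
    (φ : X ⟶ Y) :
    ∃ F : (Fin (realDim hX) → ℝ) → (Fin N' → ℝ), ContDiff ℝ ∞ F ∧
      (∀ P : AlgPoints X ℝ, F (realPt hX P) = coordMap ℝ V' f' (AlgPoints.map φ P)) ∧
      IsSemialgebraicMapOn k (range (realPt hX)) F := by
  haveI := noetherianSpace_of_isSmoothProjective hX
  haveI := isProper_of_isSmoothProjective hX
  exact (realCoordSystem hX).exists_contDiff_map hcY φ

end SmoothProjective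

/-! ### The real points of an abelian variety as an embedded Nash group -/

section AbelianVariety

variable {k : Type} [Field k] (A : Motives.AbelianVariety k)

/-- `A` is smooth projective of dimension `dim A`. [folklore] -/
theorem av_isSmoothProjective : IsSmoothProjective A.dim A.X := AbelianVariety.isSmoothProjective_holds

/-- `A × A` is smooth projective of dimension `2 dim A`. [folklore] -/
theorem av_isSmoothProjective_prod : IsSmoothProjective (A.dim + A.dim) (A.X ⊗ A.X) :=
  IsSmoothProjective.tensor_holds (av_isSmoothProjective A) (av_isSmoothProjective A)

variable [Algebra k ℝ]

/-- The coordinate embedding `A(ℝ) → ℝ^N`. [folklore] -/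
abbrev avPt : A.Points ℝ → (Fin (realDim (av_isSmoothProjective A)) → ℝ) :=
  realPt (av_isSmoothProjective A)

/-- The product coordinate system on `(A × A)(ℝ)`. [folklore] -/
theorem avProdCoordSystem :
    IsAlgCoordSystem ℝ (prodOpen A.X A.X (realOpen (av_isSmoothProjective A))
      (realOpen (av_isSmoothProjective A)))
      (prodCoords (realCoords (av_isSmoothProjective A)) (realCoords (av_isSmoothProjective A))) :=
  (realCoordSystem _).prod (realCoordSystem _)

/-- The product coordinates of a pair are the appended coordinates. [folklore] -/
theorem coordMap_avProd (Q : AlgPoints (A.X ⊗ A.X) ℝ) :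
    coordMap ℝ (prodOpen A.X A.X (realOpen (av_isSmoothProjective A))
        (realOpen (av_isSmoothProjective A)))
      (prodCoords (realCoords (av_isSmoothProjective A)) (realCoords (av_isSmoothProjective A))) Q =
      Fin.append (avPt A (AlgPoints.map (fst A.X A.X) Q)) (avPt A (AlgPoints.map (snd A.X A.X) Q)) :=
  coordMap_prodCoords _ _ Q ((realCoordSystem _).pt_mem _) ((realCoordSystem _).pt_mem _)

/-- The range of the product coordinates is `A(ℝ) × A(ℝ)` (appended). [folklore] -/
theorem range_coordMap_avProd :
    range (coordMap ℝ (prodOpen A.X A.X (realOpen (av_isSmoothProjective A))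
        (realOpen (av_isSmoothProjective A)))
      (prodCoords (realCoords (av_isSmoothProjective A)) (realCoords (av_isSmoothProjective A)))) =
      appendProd (range (avPt A)) (range (avPt A)) := by
  ext z
  constructor
  · rintro ⟨Q, rfl⟩
    rw [coordMap_avProd]
    exact append_mem_appendProd.mpr ⟨mem_range_self _, mem_range_self _⟩
  · intro hz
    obtain ⟨⟨P, hP⟩, ⟨P', hP'⟩⟩ := mem_appendProd.mp hz
    refine ⟨CartesianMonoidalCategory.lift P P', ?_⟩
    rw [coordMap_avProd]
    have h1 : AlgPoints.map (fst A.X A.X) (CartesianMonoidalCategory.lift P P') = P :=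
      CartesianMonoidalCategory.lift_fst P P'
    have h2 : AlgPoints.map (snd A.X A.X) (CartesianMonoidalCategory.lift P P') = P' :=
      CartesianMonoidalCategory.lift_snd P P'
    rw [h1, h2, hP, hP']
    exact Fin.append_castAdd_natAdd

/-- **The group law in coordinates**: a `C^∞` map `ℝ^{N+N} → ℝ^N` restricting to
`(avPt P, avPt Q) ↦ avPt (P * Q)`, `k`-semialgebraic on `A(ℝ) × A(ℝ)`.
[cite: BochnakCosteRoy1998, Prop. 2.2.7] -/
theorem exists_avMul :
    ∃ F : (Fin (realDim (av_isSmoothProjective A) + realDim (av_isSmoothProjective A)) → ℝ) →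
        (Fin (realDim (av_isSmoothProjective A)) → ℝ),
      ContDiff ℝ ∞ F ∧ (∀ P Q : A.Points ℝ, F (Fin.append (avPt A P) (avPt A Q)) = avPt A (P * Q)) ∧
        IsSemialgebraicMapOn k (appendProd (range (avPt A)) (range (avPt A))) F := by
  haveI := noetherianSpace_of_isSmoothProjective (av_isSmoothProjective_prod A)
  haveI := isProper_of_isSmoothProjective (av_isSmoothProjective_prod A)
  obtain ⟨F, hF, hFval, hFsa⟩ := (avProdCoordSystem A).exists_contDiff_map (realCoordSystem _)
    (MonObj.mul : A.X ⊗ A.X ⟶ A.X)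
  refine ⟨F, hF, fun P Q => ?_, by rwa [range_coordMap_avProd] at hFsa⟩
  have h := hFval (CartesianMonoidalCategory.lift P Q)
  rw [coordMap_avProd] at h
  have h1 : AlgPoints.map (fst A.X A.X) (CartesianMonoidalCategory.lift P Q) = P :=
    CartesianMonoidalCategory.lift_fst P Q
  have h2 : AlgPoints.map (snd A.X A.X) (CartesianMonoidalCategory.lift P Q) = Q :=
    CartesianMonoidalCategory.lift_snd P Q
  rw [h1, h2] at h
  rw [h]
  rfl

/-- **The inversion in coordinates.** [cite: BochnakCosteRoy1998, Prop. 2.2.7] -/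
theorem exists_avInv :
    ∃ F : (Fin (realDim (av_isSmoothProjective A)) → ℝ) → (Fin (realDim (av_isSmoothProjective A)) → ℝ),
      ContDiff ℝ ∞ F ∧ (∀ P : A.Points ℝ, F (avPt A P) = avPt A P⁻¹) ∧
        IsSemialgebraicMapOn k (range (avPt A)) F := by
  obtain ⟨F, hF, hFval, hFsa⟩ := exists_contDiff_realPt_map (av_isSmoothProjective A)
    (realCoordSystem (av_isSmoothProjective A)) (GrpObj.inv : A.X ⟶ A.X)
  refine ⟨F, hF, fun P => ?_, hFsa⟩
  rw [hFval P]
  rfl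

/-- The ambient group law (choice). [folklore] -/
def avMul : (Fin (realDim (av_isSmoothProjective A) + realDim (av_isSmoothProjective A)) → ℝ) →
    (Fin (realDim (av_isSmoothProjective A)) → ℝ) :=
  (exists_avMul A).choose

/-- The ambient inversion (choice). [folklore] -/
def avInv : (Fin (realDim (av_isSmoothProjective A)) → ℝ) → (Fin (realDim (av_isSmoothProjective A)) → ℝ) :=
  (exists_avInv A).choose

/-- `avMul (avPt P, avPt Q) = avPt (P Q)`. [folklore] -/
theorem avMul_append (P Q : A.Points ℝ) : avMul A (Fin.append (avPt A P) (avPt A Q)) = avPt A (P * Q) :=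
  (exists_avMul A).choose_spec.2.1 P Q

/-- `avInv (avPt P) = avPt P⁻¹`. [folklore] -/
theorem avInv_apply (P : A.Points ℝ) : avInv A (avPt A P) = avPt A P⁻¹ :=
  (exists_avInv A).choose_spec.2.1 P

variable (hk : ∀ x : k, IsAlgebraic ℚ (algebraMap k ℝ x))

/-- **The real points of an abelian variety over a real-algebraic field form an embedded compact
abelian Nash group.** [cite: Serre1988, Ch. III no. 11] [cite: BochnakCosteRoy1998, Prop. 3.3.11] -/
def avNashGroup : EmbeddedNashGroup (realDim (av_isSmoothProjective A)) A.dim where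
  pts := range (avPt A)
  isCompact_pts := isCompact_range_realPt _
  isSemialgebraic_pts := (isSemialgebraic_range_realPt _).rat_of_isAlgebraic hk
  isSubmanifold_pts := isSubmanifoldOfDim_range_realPt _
  add v w := avMul A (Fin.append v w)
  zero := avPt A 1
  neg := avInv A
  contDiff_add := (exists_avMul A).choose_spec.1.comp contDiff_append
  contDiff_neg := (exists_avInv A).choose_spec.1
  isSemialgebraicMapOn_add := by
    have h := ((exists_avMul A).choose_spec.2.2).rat_of_isAlgebraic hk
    refine h.congr fun z _ => ?_
    simp only [avMul, Fin.append_castAdd_natAdd]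
  isSemialgebraicMapOn_neg := ((exists_avInv A).choose_spec.2.2).rat_of_isAlgebraic hk
  zero_mem := mem_range_self _
  add_mem := by
    rintro _ ⟨P, rfl⟩ _ ⟨Q, rfl⟩
    rw [avMul_append]
    exact mem_range_self _
  neg_mem := by
    rintro _ ⟨P, rfl⟩
    rw [avInv_apply]
    exact mem_range_self _
  add_assoc := by
    rintro _ ⟨P, rfl⟩ _ ⟨Q, rfl⟩ _ ⟨R, rfl⟩
    rw [avMul_append, avMul_append, avMul_append, avMul_append, mul_assoc]
  add_comm := by
    rintro _ ⟨P, rfl⟩ _ ⟨Q, rfl⟩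
    rw [avMul_append, avMul_append, mul_comm]
  zero_add := by
    rintro _ ⟨P, rfl⟩
    rw [avMul_append, one_mul]
  neg_add_cancel := by
    rintro _ ⟨P, rfl⟩
    rw [avInv_apply, avMul_append, inv_mul_cancel]

/-- The underlying set of `avNashGroup`. [folklore] -/
@[simp] theorem avNashGroup_pts : (avNashGroup A hk).pts = range (avPt A) := rfl

/-- The group law of `avNashGroup` on coordinates of points. [folklore] -/
theorem avNashGroup_add_avPt (P Q : A.Points ℝ) :
    (avNashGroup A hk).add (avPt A P) (avPt A Q) = avPt A (P * Q) :=
  avMul_append A P Q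

/-- The neutral element of `avNashGroup`. [folklore] -/
@[simp] theorem avNashGroup_zero : (avNashGroup A hk).zero = avPt A 1 := rfl

end AbelianVariety

/-! ### The curve, the Abel–Jacobi map and the pulled-back coframe -/

section Curve

variable {k : Type} [Field k] [Algebra k ℝ] (hk : ∀ x : k, IsAlgebraic ℚ (algebraMap k ℝ x))
  {C : SchemeOver k} (hC : IsSmoothProjective 1 C) (P₀ : AlgPoints C k) (𝒥 : Jacobian C)

/-- **The Abel–Jacobi map in coordinates**: a `C^∞` map `ℝ^M → ℝ^N` with
`F (cPt P) = jPt (f^{P₀} P)`, `k`-semialgebraic on `C(ℝ)`.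
[cite: Milne1986JacobianVarieties, §2] [cite: BochnakCosteRoy1998, Prop. 2.2.7] -/
theorem exists_ajMap :
    ∃ F : (Fin (realDim hC) → ℝ) → (Fin (realDim (av_isSmoothProjective 𝒥.J)) → ℝ),
      ContDiff ℝ ∞ F ∧
        (∀ P : AlgPoints C ℝ, F (realPt hC P) = avPt 𝒥.J (AlgPoints.map (𝒥.abelJacobi P₀) P)) ∧
        IsSemialgebraicMapOn k (range (realPt hC)) F :=
  exists_contDiff_realPt_map hC (realCoordSystem _) (𝒥.abelJacobi P₀)

/-- The ambient Abel–Jacobi map (choice). [folklore] -/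
def ajMap : (Fin (realDim hC) → ℝ) → (Fin (realDim (av_isSmoothProjective 𝒥.J)) → ℝ) :=
  (exists_ajMap hC P₀ 𝒥).choose

/-- `ajMap` is `C^∞`. [folklore] -/
theorem contDiff_ajMap : ContDiff ℝ ∞ (ajMap hC P₀ 𝒥) :=
  (exists_ajMap hC P₀ 𝒥).choose_spec.1

/-- `ajMap (cPt P) = jPt (f^{P₀} P)`. [folklore] -/
theorem ajMap_realPt (P : AlgPoints C ℝ) :
    ajMap hC P₀ 𝒥 (realPt hC P) = avPt 𝒥.J (AlgPoints.map (𝒥.abelJacobi P₀) P) :=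
  (exists_ajMap hC P₀ 𝒥).choose_spec.2.1 P

include hk in
/-- `ajMap` is `ℚ`-semialgebraic on `C(ℝ)`. [folklore] -/
theorem isSemialgebraicMapOn_ajMap :
    IsSemialgebraicMapOn ℚ (range (realPt hC)) (ajMap hC P₀ 𝒥) :=
  ((exists_ajMap hC P₀ 𝒥).choose_spec.2.2).rat_of_isAlgebraic hk

/-- `ajMap` maps `C(ℝ)` into `J(ℝ)`. [folklore] -/
theorem ajMap_mem {x : Fin (realDim hC) → ℝ} (hx : x ∈ range (realPt hC)) :
    ajMap hC P₀ 𝒥 x ∈ range (avPt 𝒥.J) := by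
  obtain ⟨P, rfl⟩ := hx
  rw [ajMap_realPt]
  exact mem_range_self _

/-- The real base point `P₀ ∈ C(ℝ)` in coordinates. [folklore] -/
def basePt : Fin (realDim hC) → ℝ := realPt hC (toSpecOver (specOver k ℝ) ≫ P₀)

/-- `f^{P₀}(P₀) = 0` in coordinates. [cite: Milne1986JacobianVarieties, §2] -/
theorem ajMap_basePt : ajMap hC P₀ 𝒥 (basePt hC P₀) = avPt 𝒥.J 1 := by
  rw [basePt, ajMap_realPt]
  congr 1
  change (toSpecOver (specOver k ℝ) ≫ P₀) ≫ 𝒥.abelJacobi P₀ = 1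
  rw [Category.assoc, Jacobian.point_comp_abelJacobi, MonObj.comp_one]

/-- A `C^∞` field of tangent projections for `C(ℝ)` (choice,
`IsSubmanifoldOfDim.exists_contDiff_orthProj`). [folklore] -/
def curveProj : (Fin (realDim hC) → ℝ) → ((Fin (realDim hC) → ℝ) →L[ℝ] (Fin (realDim hC) → ℝ)) :=
  ((isSubmanifoldOfDim_range_realPt hC).exists_contDiff_orthProj
    (isCompact_range_realPt hC).isClosed).choose

/-- The projection field is `C^∞`. [folklore] -/
theorem contDiff_curveProj : ContDiff ℝ ∞ (curveProj hC) :=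
  ((isSubmanifoldOfDim_range_realPt hC).exists_contDiff_orthProj
    (isCompact_range_realPt hC).isClosed).choose_spec.1

/-- On `C(ℝ)` the projection field is the orthogonal tangent projection. [folklore] -/
theorem curveProj_eq {x : Fin (realDim hC) → ℝ} (hx : x ∈ range (realPt hC)) :
    curveProj hC x = orthProj (tangentSpace (range (realPt hC)) x) :=
  ((isSubmanifoldOfDim_range_realPt hC).exists_contDiff_orthProj
    (isCompact_range_realPt hC).isClosed).choose_spec.2 x hx

/-- **The pulled-back coframe** `(f^{P₀})^* ωᵢ` on `C(ℝ)`, as a field of linear forms on the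
ambient space: `x ↦ ωᵢ(aj x) ∘ D(aj)(x) ∘ π^C_x`. [cite: GrossHarris1981, §2] -/
def curveForm (i : Fin 𝒥.J.dim) (x : Fin (realDim hC) → ℝ) : (Fin (realDim hC) → ℝ) →L[ℝ] ℝ :=
  ((avNashGroup 𝒥.J hk).invForm i (ajMap hC P₀ 𝒥 x)).comp
    ((fderiv ℝ (ajMap hC P₀ 𝒥) x).comp (curveProj hC x))

/-- The pulled-back forms are `C^∞`. [folklore] -/
theorem contDiff_curveForm (i : Fin 𝒥.J.dim) : ContDiff ℝ ∞ (curveForm hk hC P₀ 𝒥 i) := by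
  have h1 : ContDiff ℝ ∞ fun x => (avNashGroup 𝒥.J hk).invForm i (ajMap hC P₀ 𝒥 x) :=
    ((avNashGroup 𝒥.J hk).contDiff_invForm i).comp (contDiff_ajMap hC P₀ 𝒥)
  have h2 : ContDiff ℝ ∞ fun x => fderiv ℝ (ajMap hC P₀ 𝒥) x :=
    (contDiff_infty_iff_fderiv.mp (contDiff_ajMap hC P₀ 𝒥)).2
  exact h1.clm_comp (h2.clm_comp (contDiff_curveProj hC))

/-- **The coefficients of the pulled-back forms are `ℚ`-semialgebraic on `C(ℝ)`.**
[cite: BochnakCosteRoy1998, Prop. 2.2.6, Prop. 3.3.11] -/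
theorem isSemialgebraicFunOn_curveForm (i : Fin 𝒥.J.dim) (j : Fin (realDim hC)) :
    IsSemialgebraicFunOn ℚ (range (realPt hC)) fun x => curveForm hk hC P₀ 𝒥 i x (Pi.single j 1) := by
  set S := range (realPt hC) with hS
  set G := avNashGroup 𝒥.J hk with hG
  set aj := ajMap hC P₀ 𝒥 with haj
  have hSsa : IsSemialgebraic ℚ S := (isSemialgebraic_range_realPt hC).rat_of_isAlgebraic hk
  have hSsub : IsSubmanifoldOfDim 1 S := isSubmanifoldOfDim_range_realPt hC
  -- the tangent field `π^C_x e_j` and its image `w(x) = D(aj)(x) (π^C_x e_j)`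
  have hu := isSemialgebraicMapOn_orthProj_single (k := ℚ) hSsub hSsa j
  have hw : IsSemialgebraicMapOn ℚ S fun x => fderiv ℝ aj x (orthProj (tangentSpace S x) (Pi.single j 1)) :=
    isSemialgebraicMapOn_fderiv_apply hSsub hSsa (contDiff_ajMap hC P₀ 𝒥)
      (isSemialgebraicMapOn_ajMap hk hC P₀ 𝒥) hu fun x _ => orthProj_mem _ _
  -- the coefficients `ωᵢ(aj x)(e_m)`
  have hcoef : ∀ m, IsSemialgebraicFunOn ℚ S fun x => G.invForm i (aj x) (Pi.single m 1) := fun m =>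
    IsSemialgebraicFunOn.comp_isSemialgebraicMapOn_holds (G.isSemialgebraicFunOn_invForm i m)
      (isSemialgebraicMapOn_ajMap hk hC P₀ 𝒥) fun x hx => ajMap_mem hC P₀ 𝒥 hx
  -- expand `ωᵢ(aj x)(w x) = Σ_m w(x)_m ωᵢ(aj x)(e_m)`
  have hsum : IsSemialgebraicFunOn ℚ S fun x => ∑ m, (fderiv ℝ aj x
      (orthProj (tangentSpace S x) (Pi.single j 1))) m * G.invForm i (aj x) (Pi.single m 1) :=
    isSemialgebraicFunOn_finset_sum hSsa Finset.univ _ fun m _ =>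
      IsSemialgebraicFunOn.mul_holds ((isSemialgebraicMapOn_iff_forall_holds hSsa).mp hw m) (hcoef m)
  refine hsum.congr fun x hx => ?_
  have hlin : ∀ (L : (Fin (realDim (av_isSmoothProjective 𝒥.J)) → ℝ) →L[ℝ] ℝ) (v : _ → ℝ),
      L v = ∑ m, v m * L (Pi.single m 1) := fun L v => by
    conv_lhs => rw [← (Pi.basisFun ℝ _).sum_repr v]
    simp [map_sum, Pi.basisFun_apply]
  simp only [curveForm, ContinuousLinearMap.comp_apply]
  rw [curveProj_eq hC hx, hlin]

/-- **`(f^{P₀})^* ωᵢ` evaluated on velocities**: for a curve `γ` in `C(ℝ)` with velocity `v` and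
`w` the velocity of `aj ∘ γ`, `ωᵢ(aj (γ 0))(w) = curveForm i (γ 0) v`. [folklore] -/
theorem invForm_ajMap (i : Fin 𝒥.J.dim) {γ : ℝ → Fin (realDim hC) → ℝ} {v : Fin (realDim hC) → ℝ}
    {w : Fin (realDim (av_isSmoothProjective 𝒥.J)) → ℝ} (hγ : ∀ᶠ s in 𝓝 (0 : ℝ), γ s ∈ range (realPt hC))
    (hv : HasDerivAt γ v 0) (hw : HasDerivAt (fun s => ajMap hC P₀ 𝒥 (γ s)) w 0) :
    (avNashGroup 𝒥.J hk).invForm i (ajMap hC P₀ 𝒥 (γ 0)) w = curveForm hk hC P₀ 𝒥 i (γ 0) v := by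
  have hx : γ 0 ∈ range (realPt hC) := hγ.self_of_nhds
  have hvT : v ∈ tangentSpace (range (realPt hC)) (γ 0) :=
    (mem_tangentSpace_iff (isSubmanifoldOfDim_range_realPt hC) hx).mpr ⟨γ, hγ, rfl, hv⟩
  have hd : HasDerivAt (fun s => ajMap hC P₀ 𝒥 (γ s)) (fderiv ℝ (ajMap hC P₀ 𝒥) (γ 0) v) 0 :=
    (((contDiff_ajMap hC P₀ 𝒥).differentiable (by simp)) (γ 0)).hasFDerivAt.comp_hasDerivAt (0 : ℝ) hv
  have hwv : fderiv ℝ (ajMap hC P₀ 𝒥) (γ 0) v = w := hd.unique hw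
  simp only [curveForm, ContinuousLinearMap.comp_apply]
  rw [curveProj_eq hC hx, orthProj_eq_self _ hvT, hwv]

/-- **The real Abel–Jacobi package of `(C, P₀, 𝒥)`.** [cite: GrossHarris1981, §§1–2] -/
def realAbelJacobi : RealAbelJacobi (realDim hC) (realDim (av_isSmoothProjective 𝒥.J)) 𝒥.J.dim where
  toCompactAbelianNashGroup := (avNashGroup 𝒥.J hk).toCompactAbelianNashGroup
  C := range (realPt hC)
  isCompact_C := isCompact_range_realPt hC
  isSemialgebraic_C := (isSemialgebraic_range_realPt hC).rat_of_isAlgebraic hk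
  isSubmanifold_C := isSubmanifoldOfDim_range_realPt hC
  base := basePt hC P₀
  base_mem := mem_range_self _
  aj := ajMap hC P₀ 𝒥
  contDiffAt_aj := fun _ _ => (contDiff_ajMap hC P₀ 𝒥).contDiffAt
  isSemialgebraicMapOn_aj := isSemialgebraicMapOn_ajMap hk hC P₀ 𝒥
  aj_mem := fun _ hx => ajMap_mem hC P₀ 𝒥 hx
  aj_base := ajMap_basePt hC P₀ 𝒥
  curveForm := curveForm hk hC P₀ 𝒥
  contDiffAt_curveForm := fun i _ _ => (contDiff_curveForm hk hC P₀ 𝒥 i).contDiffAt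
  isSemialgebraicFunOn_curveForm := isSemialgebraicFunOn_curveForm hk hC P₀ 𝒥
  invForm_aj := fun i _ _ _ hγ hv hw => invForm_ajMap hk hC P₀ 𝒥 i hγ hv hw

/-- **The package is realised by `(C, P₀, 𝒥)`.** [cite: GrossHarris1981, §§1–2] -/
def realization : (realAbelJacobi hk hC P₀ 𝒥).Realization C P₀ 𝒥 where
  eC := realPt hC
  isEmbedding_eC := (isClosedEmbedding_realPt hC).isEmbedding
  range_eC := rfl
  eC_base := rfl
  exists_eval_eq_eC := ⟨realOpen hC, realCoords hC, (realCoordSystem hC).pt_mem,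
    fun P j => coordMap_apply_of_mem ((realCoordSystem hC).pt_mem P) j⟩
  exists_isSemialgebraicFunOn_eval_C := fun U s => by
    obtain ⟨F, hF, hFval⟩ := exists_isSemialgebraicFunOn_eval_realPt hC s
    exact ⟨F, hF.rat_of_isAlgebraic hk, hFval⟩
  eJ := avPt 𝒥.J
  isEmbedding_eJ := (isClosedEmbedding_realPt _).isEmbedding
  range_eJ := rfl
  eJ_mul := fun P Q => (avNashGroup_add_avPt 𝒥.J hk P Q).symm
  exists_eval_eq_eJ := ⟨realOpen _, realCoords _, (realCoordSystem _).pt_mem,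
    fun P j => coordMap_apply_of_mem ((realCoordSystem _).pt_mem P) j⟩
  exists_isSemialgebraicFunOn_eval_J := fun U s => by
    obtain ⟨F, hF, hFval⟩ := exists_isSemialgebraicFunOn_eval_realPt (av_isSmoothProjective 𝒥.J) s
    exact ⟨F, hF.rat_of_isAlgebraic hk, hFval⟩
  eJ_abelJacobi := fun P => (ajMap_realPt hC P₀ 𝒥 P).symm

end Curve

end Literature.AlgebraicGeometry.RealAlgebraic

/-! ### The discharge -/

namespace Literature.AlgebraicGeometry.RealAlgebraic.RealAbelJacobi

/-- **Discharge of `RealAbelJacobi.exists_realization`**: over a real-algebraic field, the real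
points of a smooth projective geometrically irreducible curve with a rational point and of a
Jacobian form a real Abel–Jacobi package realised by them. [cite: GrossHarris1981, §§1–2]
[cite: BochnakCosteRoy1998, Thm. 3.4.4, Prop. 3.3.11] [cite: Serre1988, Ch. III no. 11] -/
theorem exists_realization_holds : exists_realization := by
  intro k _ _ hk C hC P₀ 𝒥
  exact ⟨_, _, realAbelJacobi hk hC P₀ 𝒥, ⟨realization hk hC P₀ 𝒥⟩⟩

end Literature.AlgebraicGeometry.RealAlgebraic.RealAbelJacobi

end
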